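import Summits.AnomalousDissipation.AnomalousDissipation.Theorems.SawtoothPulseCascadeApproxProfileFourier

/-!
# The Gaussian factor in the Fourier coefficients of the rounded-sawtooth profile
(route `AnomalousDissipation/SawtoothPulseCascade`; helper for the crux ApproxSol58 =
stmt-AnomalousDissipation-19688, registered stub `stub_responseL2` / S1 `stub_responseL2Envelope`:
the realignment pipeline, profile side, part 2)

Sequel of `SawtoothPulseCascadeApproxProfileFourier`: the period-`1` Fourier coefficients of the
ROUNDED profile `y ↦ roundedSaw δ (2πN y) = ∫ tri (2πNy − z) g_δ(z) dz` are those of the sharp profile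
`f_N(y) = tri (2πN y)` times the Gaussian factor `exp (−δ²m²/(2N²))` (Fubini on `[0,1] × ℝ`,
translation by `z/(2πN)`, and `∫ g_δ(z) e^{−iξz} dz = e^{−δ²ξ²/2}` from Mathlib's
`integral_cexp_quadratic`).  Consequences for the normalised cascade profile
`u(y) = roundedSaw δ (2πN y)/(2πN)` (the shape of `CascadeParams.U`): Fourier support on the odd
multiples of `N`, zero mean, and `‖𝓕(u)(m)‖ ≤ e^{−δ²m²/(2N²)} · 3N/(2π²m²)`.  The Gaussian factor is
what makes the backward heat realignment of the cascade's heat-lag injections legitimate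
(`exp (+4π²νm²τ) · exp (−δ²m²/(2N²))` stays summable while `8π²νN²τ < δ²`).
-/

set_option linter.dupNamespace false

noncomputable section

namespace Summit.AnomalousDissipation.AnomalousDissipation.Theorems.SawtoothPulseCascade.ApproxResponse

open Set MeasureTheory Complex intervalIntegral
open Literature.Analysis Literature.Analysis.FluidPDE
open Literature.Analysis.FluidPDE.SawtoothCascade

/-! ## §5 The Gaussian factor of the rounded profile -/

/-- The Gaussian integral behind the realignment: `∫ g_δ(z) e^{-iξz} dz = e^{-δ²ξ²/2}` (`δ > 0`). -/
theorem integral_gaussKernel_mul_cexp {δ : ℝ} (hδ : 0 < δ) (ξ : ℝ) :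
    ∫ z : ℝ, (gaussKernel δ z : ℂ) * cexp (-(I * ξ * z)) = (Real.exp (-(δ ^ 2 * ξ ^ 2 / 2)) : ℂ) := by
  set b : ℂ := ((-(1 / (2 * δ ^ 2)) : ℝ) : ℂ) with hb_def
  have hb : b.re < 0 := by
    rw [hb_def, Complex.ofReal_re]
    have : 0 < 1 / (2 * δ ^ 2) := by positivity
    linarith
  have hK : (0 : ℝ) < δ * Real.sqrt (2 * Real.pi) := by positivity
  -- rewrite the integrand in the normal form of `integral_cexp_quadratic`
  have hform : (fun z : ℝ => (gaussKernel δ z : ℂ) * cexp (-(I * ξ * z))) =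
      fun z : ℝ => ((1 / (δ * Real.sqrt (2 * Real.pi)) : ℝ) : ℂ) * cexp (b * z ^ 2 + (-(I * ξ)) * z + 0) := by
    funext z
    simp only [gaussKernel, Complex.ofReal_div, Complex.ofReal_exp, hb_def]
    rw [add_zero, Complex.exp_add]
    push_cast
    field_simp
  rw [hform, MeasureTheory.integral_const_mul, integral_cexp_quadratic hb]
  -- simplify `(π / -b)^{1/2} = δ √(2π)` and the exponent
  have hπb : (Real.pi : ℂ) / -b = (((2 * Real.pi * δ ^ 2 : ℝ)) : ℂ) := by
    rw [hb_def]
    have hδ' : (δ : ℂ) ≠ 0 := by exact_mod_cast hδ.ne'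
    push_cast
    field_simp
  have hroot : ((Real.pi : ℂ) / -b) ^ (1 / 2 : ℂ) = ((δ * Real.sqrt (2 * Real.pi) : ℝ) : ℂ) := by
    rw [hπb, show (1 / 2 : ℂ) = ((1 / 2 : ℝ) : ℂ) by push_cast; ring,
      ← Complex.ofReal_cpow (by positivity : (0 : ℝ) ≤ 2 * Real.pi * δ ^ 2), ← Real.sqrt_eq_rpow,
      show 2 * Real.pi * δ ^ 2 = (2 * Real.pi) * δ ^ 2 by ring,
      Real.sqrt_mul (by positivity : (0 : ℝ) ≤ 2 * Real.pi), Real.sqrt_sq hδ.le, mul_comm]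
  have hexp : (0 : ℂ) - (-(I * ξ)) ^ 2 / (4 * b) = ((-(δ ^ 2 * ξ ^ 2 / 2) : ℝ) : ℂ) := by
    rw [hb_def]
    have hδ' : (δ : ℂ) ≠ 0 := by exact_mod_cast hδ.ne'
    push_cast
    field_simp
    rw [Complex.I_sq]
    ring
  rw [hroot, hexp, ← Complex.ofReal_exp, ← Complex.ofReal_mul, ← Complex.ofReal_mul]
  congr 1
  field_simp

/-- Joint continuity of the Fubini integrand `(y, z) ↦ e^{-2πimy} tri(2πNy − z) g_δ(z)`. -/
private theorem continuous_fubini_integrand (δ : ℝ) (N : ℕ) (m : ℤ) :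
    Continuous fun p : ℝ × ℝ =>
      fourier (-m) (p.1 : AddCircle (1 : ℝ)) * ((tri (2 * Real.pi * N * p.1 - p.2) * gaussKernel δ p.2 : ℝ) : ℂ) := by
  refine (((fourier (-m)).continuous.comp ((AddCircle.continuous_mk' (1 : ℝ)).comp continuous_fst)).mul
    (Complex.continuous_ofReal.comp ?_))
  refine (continuous_tri.comp ((continuous_const.mul continuous_fst).sub continuous_snd)).mul ?_
  unfold gaussKernel
  fun_prop

/-- **The Gaussian factor.** The period-`1` Fourier coefficients of the rounded profile
`y ↦ roundedSaw δ (2πN y) = ∫ tri(2πNy − z) g_δ(z) dz` are those of the sharp profile times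
`exp (−δ²m²/(2N²))` (Fubini, translation by `z/(2πN)`, Gaussian integral). -/
theorem fourierCoeff_roundedSaw_mul {δ : ℝ} (hδ : 0 < δ) {N : ℕ} (hN : N ≠ 0) (m : ℤ) :
    fourierCoeff (AddCircle.liftIco 1 0 fun y : ℝ => (roundedSaw δ (2 * Real.pi * N * y) : ℂ)) m =
      (Real.exp (-(δ ^ 2 * (m : ℝ) ^ 2 / (2 * (N : ℝ) ^ 2))) : ℂ) *
        fourierCoeff (AddCircle.liftIco 1 0 fun y : ℝ => (tri (2 * Real.pi * N * y) : ℂ)) m := by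
  have hN' : (N : ℝ) ≠ 0 := Nat.cast_ne_zero.2 hN
  have hπ := Real.pi_pos
  set e : ℝ → ℂ := fun y => fourier (-m) (y : AddCircle (1 : ℝ)) with he
  set Φ : ℝ → ℝ → ℂ := fun y z =>
    e y * ((tri (2 * Real.pi * N * y - z) * gaussKernel δ z : ℝ) : ℂ) with hΦ
  -- Step 1: the coefficient as an iterated integral
  have h1 : fourierCoeff (AddCircle.liftIco 1 0 fun y : ℝ => (roundedSaw δ (2 * Real.pi * N * y) : ℂ)) m =
      ∫ y in (0 : ℝ)..1, ∫ z, Φ y z := by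
    rw [fourierCoeff_liftIco_eq_integral]
    refine intervalIntegral.integral_congr fun y _ => ?_
    simp only [hΦ, he, roundedSaw]
    rw [← integral_complex_ofReal, ← MeasureTheory.integral_const_mul]
  -- Step 2: Fubini on `[0,1] × ℝ`
  have hint : Integrable (Function.uncurry Φ) ((volume.restrict (Ioc (0 : ℝ) 1)).prod volume) := by
    have hdom : Integrable (fun p : ℝ × ℝ => (1 : ℝ) * ((Real.pi / 2) * gaussKernel δ p.2))
        ((volume.restrict (Ioc (0 : ℝ) 1)).prod volume) := by
      have hc1 : Integrable (fun _ : ℝ => (1 : ℝ)) (volume.restrict (Ioc (0 : ℝ) 1)) :=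
        (continuous_const.integrableOn_Icc (a := (0 : ℝ)) (b := 1)).mono_set Ioc_subset_Icc_self
      exact Integrable.mul_prod (μ := volume.restrict (Ioc (0 : ℝ) 1)) (ν := volume) hc1
        ((integrable_gaussKernel hδ).const_mul _)
    refine hdom.mono' ((continuous_fubini_integrand δ N m).aestronglyMeasurable) (ae_of_all _ fun p => ?_)
    simp only [Function.uncurry, hΦ, he, one_mul]
    rw [norm_mul, norm_fourier_neg_coe, one_mul, Complex.norm_real, Real.norm_eq_abs, abs_mul,
      abs_of_nonneg (gaussKernel_nonneg hδ.le _)]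
    exact mul_le_mul_of_nonneg_right (abs_tri_le _) (gaussKernel_nonneg hδ.le _)
  have h2 : (∫ y in (0 : ℝ)..1, ∫ z, Φ y z) = ∫ z, ∫ y in (0 : ℝ)..1, Φ y z := by
    rw [intervalIntegral.integral_of_le zero_le_one, integral_integral_swap hint]
    congr 1
    funext z
    rw [intervalIntegral.integral_of_le zero_le_one]
  -- Step 3: the inner integral by translation
  have h3 : ∀ z, (∫ y in (0 : ℝ)..1, Φ y z) =
      ((gaussKernel δ z : ℝ) : ℂ) * (e (z / (2 * Real.pi * N)) *
        fourierCoeff (AddCircle.liftIco 1 0 fun y : ℝ => (tri (2 * Real.pi * N * y) : ℂ)) m) := by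
    intro z
    rw [← integral_fourier_mul_comp_sub (G := fun y : ℝ => (tri (2 * Real.pi * N * y) : ℂ))
      (fun y => by simp only [periodic_tri_mul N y]) m (z / (2 * Real.pi * N)),
      ← intervalIntegral.integral_const_mul]
    refine intervalIntegral.integral_congr fun y _ => ?_
    simp only [hΦ, he]
    rw [show 2 * Real.pi * N * (y - z / (2 * Real.pi * N)) = 2 * Real.pi * N * y - z by field_simp]
    push_cast
    ring
  -- Step 4: the Gaussian integral
  have h4 : (∫ z, ((gaussKernel δ z : ℝ) : ℂ) * e (z / (2 * Real.pi * N))) =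
      (Real.exp (-(δ ^ 2 * (m : ℝ) ^ 2 / (2 * (N : ℝ) ^ 2))) : ℂ) := by
    have hfun : (fun z => ((gaussKernel δ z : ℝ) : ℂ) * e (z / (2 * Real.pi * N))) =
        fun z => ((gaussKernel δ z : ℝ) : ℂ) * cexp (-(I * ((m : ℝ) / N : ℝ) * z)) := by
      funext z
      simp only [he]
      rw [fourier_neg_coe]
      congr 2
      push_cast
      field_simp
    rw [hfun, integral_gaussKernel_mul_cexp hδ]
    congr 1
    field_simp
  rw [h1, h2]
  simp_rw [h3]
  rw [show (fun z => ((gaussKernel δ z : ℝ) : ℂ) * (e (z / (2 * Real.pi * N)) *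
      fourierCoeff (AddCircle.liftIco 1 0 fun y : ℝ => (tri (2 * Real.pi * N * y) : ℂ)) m)) =
      fun z => (((gaussKernel δ z : ℝ) : ℂ) * e (z / (2 * Real.pi * N))) *
        fourierCoeff (AddCircle.liftIco 1 0 fun y : ℝ => (tri (2 * Real.pi * N * y) : ℂ)) m by
      funext z; ring, MeasureTheory.integral_mul_const, h4]


/-! ## §6 The normalised cascade profile `u(y) = roundedSaw δ (2πN y) / (2πN)` -/

/-- Coefficients of the normalised profile: `𝓕(u)(m) = e^{-δ²m²/(2N²)} 𝓕(f_N)(m) / (2πN)`. -/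
theorem fourierCoeff_profile {δ : ℝ} (hδ : 0 < δ) {N : ℕ} (hN : N ≠ 0) (m : ℤ) :
    fourierCoeff (AddCircle.liftIco 1 0 fun y : ℝ =>
        ((roundedSaw δ (2 * Real.pi * N * y) / (2 * Real.pi * N) : ℝ) : ℂ)) m =
      (Real.exp (-(δ ^ 2 * (m : ℝ) ^ 2 / (2 * (N : ℝ) ^ 2))) : ℂ) *
        fourierCoeff (AddCircle.liftIco 1 0 fun y : ℝ => (tri (2 * Real.pi * N * y) : ℂ)) m /
          ((2 * Real.pi * N : ℝ) : ℂ) := by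
  rw [← fourierCoeff_roundedSaw_mul hδ hN m, fourierCoeff_liftIco_eq_integral,
    fourierCoeff_liftIco_eq_integral, ← intervalIntegral.integral_div]
  refine intervalIntegral.integral_congr fun y _ => ?_
  push_cast
  ring

/-- The normalised profile is Fourier-supported on the odd multiples of `N`. -/
theorem fourierCoeff_profile_eq_zero {δ : ℝ} (hδ : 0 < δ) {N : ℕ} (hN : N ≠ 0) {m : ℤ}
    (hm : ¬ ∃ n : ℤ, m = (2 * n + 1) * (N : ℤ)) :
    fourierCoeff (AddCircle.liftIco 1 0 fun y : ℝ =>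
        ((roundedSaw δ (2 * Real.pi * N * y) / (2 * Real.pi * N) : ℝ) : ℂ)) m = 0 := by
  rw [fourierCoeff_profile hδ hN, fourierCoeff_tri_mul_eq_zero hN hm, mul_zero, zero_div]

/-- In particular the normalised profile has zero mean (`m = 0` is not an odd multiple of `N ≠ 0`). -/
theorem fourierCoeff_profile_zero {δ : ℝ} (hδ : 0 < δ) {N : ℕ} (hN : N ≠ 0) :
    fourierCoeff (AddCircle.liftIco 1 0 fun y : ℝ =>
        ((roundedSaw δ (2 * Real.pi * N * y) / (2 * Real.pi * N) : ℝ) : ℂ)) 0 = 0 := by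
  refine fourierCoeff_profile_eq_zero hδ hN ?_
  rintro ⟨n, hn⟩
  have hN' : (N : ℤ) ≠ 0 := by exact_mod_cast hN
  have h2 : (2 * n + 1 : ℤ) ≠ 0 := by omega
  exact (mul_ne_zero h2 hN') hn.symm

/-- **Gaussian coefficient bound for the normalised profile**:
`‖𝓕(u)(m)‖ ≤ e^{-δ²m²/(2N²)} · 3N/(2π² m²)` for `m ≠ 0`. -/
theorem norm_fourierCoeff_profile_le {δ : ℝ} (hδ : 0 < δ) {N : ℕ} (hN : N ≠ 0) {m : ℤ} (hm : m ≠ 0) :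
    ‖fourierCoeff (AddCircle.liftIco 1 0 fun y : ℝ =>
        ((roundedSaw δ (2 * Real.pi * N * y) / (2 * Real.pi * N) : ℝ) : ℂ)) m‖ ≤
      Real.exp (-(δ ^ 2 * (m : ℝ) ^ 2 / (2 * (N : ℝ) ^ 2))) * (3 * N / (2 * Real.pi ^ 2 * (m : ℝ) ^ 2)) := by
  have hπ := Real.pi_pos
  have hN' : (0 : ℝ) < N := Nat.cast_pos.2 (Nat.pos_of_ne_zero hN)
  rw [fourierCoeff_profile hδ hN m, norm_div, norm_mul, Complex.norm_real, Complex.norm_real,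
    Real.norm_of_nonneg (Real.exp_pos _).le, Real.norm_of_nonneg (by positivity), mul_div_assoc]
  refine mul_le_mul_of_nonneg_left ?_ (Real.exp_pos _).le
  rw [div_le_iff₀ (by positivity)]
  refine (norm_fourierCoeff_tri_mul_le hN hm).trans (le_of_eq ?_)
  field_simp

end Summit.AnomalousDissipation.AnomalousDissipation.Theorems.SawtoothPulseCascade.ApproxResponse

end
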